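import Mathlib
import Summits.Ventures.PercRepro2.Defs
import Summits.Ventures.PercRepro2.Independence
import Summits.Ventures.PercRepro2.Harris
import Summits.Ventures.PercRepro2.Graph
import Summits.Ventures.PercRepro2.Events
import Summits.Ventures.PercRepro2.Induced
import Summits.Ventures.PercRepro2.Frontier

/-!
# The merged V-family behind (B-T): definitions (blind cell PercRepro2, mine-1 g52)

`(B-T)` is the log-supermodular pair `m(NST) m(STN) ≤ m(SSN) m(NTT)` of the three-status law on
`{s ↮ t}` (coordinates `(u, v, w)`; `S` = in `C_s`, `T` = in `C_t`, `N` = in neither), the single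
three-vertex class outside the two-cluster four-functions corollary of `LSMPairTheorems.lean`.
It is proved (`BTVFamily.lean`) through a statement with SET-valued `u` and `w` (paper
proofs/MINE1-BT.md §2): for vertex sets `A, W` (the "frontiers" of `u` and `w`) the four cells
become, on the induced subgraph `G[U]`,

  `a(A,W) = {v ↔ s, t ↔ W, s ↮ {t} ∪ A ∪ W, t ↮ A, W ↮ A}`     (`NST` with `u ~ A`, `w ~ W`)
  `b(A,W) = {v ↔ t, s ↔ A, t ↮ {s} ∪ A ∪ W, s ↮ W, A ↮ W}`     (`STN`)
  `j(A,W) = {s ↔ A, v ↔ {s} ∪ A, t ↮ {s} ∪ A ∪ W, ({s} ∪ A) ↮ W}`   (`SSN`)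
  `m(A,W) = {t ↔ W, v ↔ {t} ∪ W, s ↮ {t} ∪ A ∪ W, ({t} ∪ W) ↮ A}`   (`NTT`)

(`X ↔ Y` = some vertex of `X` is connected to some vertex of `Y`).  This file defines the four
cells, proves the monotonicity `m` antitone in `A`, `j` antitone in `W`, the degenerate cases
(a terminal or an overlap inside a frontier set empties a cell), and the connectivity lemmas for
revealing the edges at one vertex `z` (`connSet_reveal`: for `z ∈ X`, `z ∉ Y`, `X ↔ Y` in `G[U]`
iff `(X ∖ z) ∪ frontier(z) ↔ Y` in `G[U ∖ z]`).
-/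

namespace Summit.Ventures.PercRepro2

namespace BTVFamily

/-! ## Set connectivity and the four merged cells -/

section Defs

variable {V : Type*} {E : Type*}

/-- `X ↔ Y`: some vertex of `X` is connected to some vertex of `Y` (whole configuration). -/
def ConnSet (ends : E → Sym2 V) (ω : Config E) (X Y : Finset V) : Prop :=
  ∃ x ∈ X, ∃ y ∈ Y, Conn ends ω x y

variable {ends : E → Sym2 V} {ω : Config E}

/-- `X ↔ Y` is monotone in `X`. -/
lemma connSet_mono_left {X X' Y : Finset V} (h : X ⊆ X') (hc : ConnSet ends ω X Y) :
    ConnSet ends ω X' Y := by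
  obtain ⟨x, hx, y, hy, hxy⟩ := hc
  exact ⟨x, h hx, y, hy, hxy⟩

/-- `X ↔ Y` is monotone in `Y`. -/
lemma connSet_mono_right {X Y Y' : Finset V} (h : Y ⊆ Y') (hc : ConnSet ends ω X Y) :
    ConnSet ends ω X Y' := by
  obtain ⟨x, hx, y, hy, hxy⟩ := hc
  exact ⟨x, hx, y, h hy, hxy⟩

/-- `X ↔ Y` iff `Y ↔ X`. -/
lemma connSet_comm {X Y : Finset V} : ConnSet ends ω X Y ↔ ConnSet ends ω Y X := by
  constructor <;> rintro ⟨x, hx, y, hy, hxy⟩ <;> exact ⟨y, hy, x, hx, conn_symm hxy⟩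

/-- `{x} ↔ Y` iff `x` is connected to some vertex of `Y`. -/
lemma connSet_singleton_left {x : V} {Y : Finset V} :
    ConnSet ends ω {x} Y ↔ ∃ y ∈ Y, Conn ends ω x y := by
  constructor
  · rintro ⟨x', hx', y, hy, h⟩
    rw [Finset.mem_singleton] at hx'
    subst hx'
    exact ⟨y, hy, h⟩
  · rintro ⟨y, hy, h⟩
    exact ⟨x, Finset.mem_singleton_self x, y, hy, h⟩

/-- `X ↔ Y` is monotone in the configuration. -/
lemma connSet_mono_config {ω ω' : Config E} (h : ω ≤ ω') {X Y : Finset V}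
    (hc : ConnSet ends ω X Y) : ConnSet ends ω' X Y := by
  obtain ⟨x, hx, y, hy, hxy⟩ := hc
  exact ⟨x, hx, y, hy, conn_mono h hxy⟩

variable [DecidableEq V]

/-- The cell `NST` with `u ~ A`, `w ~ W`, as a predicate on a configuration. -/
def aProp (ends : E → Sym2 V) (s t v : V) (A W : Finset V) (ω : Config E) : Prop :=
  Conn ends ω v s ∧ ConnSet ends ω {t} W ∧ ¬ ConnSet ends ω {s} ({t} ∪ A ∪ W) ∧
    ¬ ConnSet ends ω {t} A ∧ ¬ ConnSet ends ω W A

/-- The cell `STN`. -/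
def bProp (ends : E → Sym2 V) (s t v : V) (A W : Finset V) (ω : Config E) : Prop :=
  Conn ends ω v t ∧ ConnSet ends ω {s} A ∧ ¬ ConnSet ends ω {t} ({s} ∪ A ∪ W) ∧
    ¬ ConnSet ends ω {s} W ∧ ¬ ConnSet ends ω A W

/-- The cell `SSN`. -/
def jProp (ends : E → Sym2 V) (s t v : V) (A W : Finset V) (ω : Config E) : Prop :=
  ConnSet ends ω {s} A ∧ ConnSet ends ω {v} ({s} ∪ A) ∧ ¬ ConnSet ends ω {t} ({s} ∪ A ∪ W) ∧
    ¬ ConnSet ends ω ({s} ∪ A) W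

/-- The cell `NTT`. -/
def mProp (ends : E → Sym2 V) (s t v : V) (A W : Finset V) (ω : Config E) : Prop :=
  ConnSet ends ω {t} W ∧ ConnSet ends ω {v} ({t} ∪ W) ∧ ¬ ConnSet ends ω {s} ({t} ∪ A ∪ W) ∧
    ¬ ConnSet ends ω ({t} ∪ W) A

/-- The four cells on the induced subgraph `G[U]`. -/
def aEv (ends : E → Sym2 V) (U : Finset V) (s t v : V) (A W : Finset V) : Set (Config E) :=
  {ω | aProp ends s t v A W (induced ends (↑U) ω)}

/-- The cell `STN` on `G[U]`. -/
def bEv (ends : E → Sym2 V) (U : Finset V) (s t v : V) (A W : Finset V) : Set (Config E) :=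
  {ω | bProp ends s t v A W (induced ends (↑U) ω)}

/-- The cell `SSN` on `G[U]`. -/
def jEv (ends : E → Sym2 V) (U : Finset V) (s t v : V) (A W : Finset V) : Set (Config E) :=
  {ω | jProp ends s t v A W (induced ends (↑U) ω)}

/-- The cell `NTT` on `G[U]`. -/
def mEv (ends : E → Sym2 V) (U : Finset V) (s t v : V) (A W : Finset V) : Set (Config E) :=
  {ω | mProp ends s t v A W (induced ends (↑U) ω)}

/-- The cell `m` is antitone in `A`: merging more into `u` makes `u ∈ N` harder. -/
lemma mEv_anti_left (ends : E → Sym2 V) (U : Finset V) (s t v : V) {A A' : Finset V}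
    (h : A ⊆ A') (W : Finset V) : mEv ends U s t v A' W ⊆ mEv ends U s t v A W := by
  rintro ω ⟨h1, h2, h3, h4⟩
  refine ⟨h1, h2, fun hc => h3 ?_, fun hc => h4 (connSet_mono_right h hc)⟩
  exact connSet_mono_right (Finset.union_subset_union_left (Finset.union_subset_union_right h)) hc

/-- The cell `j` is antitone in `W`. -/
lemma jEv_anti_right (ends : E → Sym2 V) (U : Finset V) (s t v : V) (A : Finset V)
    {W W' : Finset V} (h : W ⊆ W') : jEv ends U s t v A W' ⊆ jEv ends U s t v A W := by
  rintro ω ⟨h1, h2, h3, h4⟩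
  refine ⟨h1, h2, fun hc => h3 (connSet_mono_right (Finset.union_subset_union_right h) hc),
    fun hc => h4 (connSet_mono_right h hc)⟩

end Defs

/-! ## Revealing the edges at one vertex: connectivity through `z` -/

section Reveal

variable {V : Type*} {E : Type*} [Fintype E] [DecidableEq V] {ends : E → Sym2 V} {U : Finset V}
  {z : V} {ω : Config E}

omit [Fintype E] in
/-- Connections in `G[U ∖ z]` are connections in `G[U]`. -/
lemma conn_of_conn_sdiff {x y : V} (h : Conn ends (induced ends (↑(U \ {z})) ω) x y) :
    Conn ends (induced ends (↑U) ω) x y :=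
  conn_mono (induced_mono_set (Finset.coe_subset.2 Finset.sdiff_subset) ω) h

/-- A frontier vertex of `z` is joined to `z` by an open edge of `G[U]`. -/
lemma conn_frontier_of_mem (hzU : z ∈ U) {y : V} (hy : y ∈ frontier ends U {z} ω) :
    Conn ends (induced ends (↑U) ω) z y := by
  obtain ⟨⟨hyU, _⟩, e, he, z', hz', hends⟩ := mem_frontier.1 hy
  rw [Finset.mem_singleton] at hz'
  rw [hz'] at hends
  refine conn_symm (conn_of_openAdj ⟨e, ?_, hends⟩)
  exact induced_eq_true_iff.2 ⟨he, y, Finset.mem_coe.2 hyU, z, Finset.mem_coe.2 hzU, hends⟩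

/-- `x ≠ z` reaches `z` in `G[U]` iff it reaches the frontier of `z` in `G[U ∖ z]`. -/
lemma conn_z_iff (hzU : z ∈ U) {x : V} (hxz : x ≠ z) :
    Conn ends (induced ends (↑U) ω) x z ↔
      ∃ y ∈ frontier ends U {z} ω, Conn ends (induced ends (↑(U \ {z})) ω) x y := by
  constructor
  · intro h
    by_contra hne
    exact not_conn_of_not_conn_frontier (Z := {z}) (by simpa using hxz)
      (fun y hy hxy => hne ⟨y, hy, hxy⟩) z (Finset.mem_singleton_self z) h
  · rintro ⟨y, hy, hxy⟩
    exact conn_trans (conn_of_conn_sdiff hxy) (conn_symm (conn_frontier_of_mem hzU hy))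

omit [Fintype E] in
/-- Dichotomy: a connection of `x ≠ z` in `G[U]` either survives in `G[U ∖ z]` or passes through
`z`. -/
lemma conn_sdiff_or_conn_z {x c : V} (h : Conn ends (induced ends (↑U) ω) x c) :
    Conn ends (induced ends (↑(U \ {z})) ω) x c ∨ Conn ends (induced ends (↑U) ω) x z := by
  by_cases hxz : Conn ends (induced ends (↑U) ω) x z
  · exact Or.inr hxz
  · left
    refine conn_induced_sdiff_of_conn (Z := {z}) ?_ h
    intro z' hz'
    rw [Finset.mem_singleton] at hz'
    subst hz'
    exact hxz

/-- **Revealing `z` inside a source set**: for `z ∈ X`, `z ∉ Y`,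
`X ↔ Y` in `G[U]` iff `(X ∖ z) ∪ frontier ↔ Y` in `G[U ∖ z]`. -/
lemma connSet_reveal (hzU : z ∈ U) {X Y : Finset V} (hzX : z ∈ X) (hzY : z ∉ Y) :
    ConnSet ends (induced ends (↑U) ω) X Y ↔
      ConnSet ends (induced ends (↑(U \ {z})) ω) (X.erase z ∪ frontier ends U {z} ω) Y := by
  constructor
  · rintro ⟨x, hx, y, hy, hxy⟩
    have hyz : y ≠ z := fun h => hzY (h ▸ hy)
    by_cases hxz : x = z
    · subst hxz
      obtain ⟨y', hy', hyy'⟩ := (conn_z_iff hzU hyz).1 (conn_symm hxy)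
      exact ⟨y', Finset.mem_union_right _ hy', y, hy, conn_symm hyy'⟩
    · rcases conn_sdiff_or_conn_z (z := z) hxy with h | h
      · exact ⟨x, Finset.mem_union_left _ (Finset.mem_erase.2 ⟨hxz, hx⟩), y, hy, h⟩
      · obtain ⟨y', hy', hyy'⟩ := (conn_z_iff hzU hyz).1 (conn_trans (conn_symm hxy) h)
        exact ⟨y', Finset.mem_union_right _ hy', y, hy, conn_symm hyy'⟩
  · rintro ⟨x, hx, y, hy, hxy⟩
    rcases Finset.mem_union.1 hx with hx | hx
    · exact ⟨x, Finset.mem_of_mem_erase hx, y, hy, conn_of_conn_sdiff hxy⟩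
    · exact ⟨z, hzX, y, hy, conn_trans (conn_frontier_of_mem hzU hx) (conn_of_conn_sdiff hxy)⟩

/-- The mirror image of `connSet_reveal` (`z` in the target set). -/
lemma connSet_reveal' (hzU : z ∈ U) {X Y : Finset V} (hzX : z ∉ X) (hzY : z ∈ Y) :
    ConnSet ends (induced ends (↑U) ω) X Y ↔
      ConnSet ends (induced ends (↑(U \ {z})) ω) X (Y.erase z ∪ frontier ends U {z} ω) := by
  rw [connSet_comm, connSet_reveal hzU hzY hzX, connSet_comm]

omit [Fintype E] in
/-- **Revealing `z` away from the sources**: if no source reaches `z`, connections are the same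
in `G[U]` and in `G[U ∖ z]`. -/
lemma connSet_sdiff_of_not_conn_z {X Y : Finset V}
    (hX : ∀ x ∈ X, ¬ Conn ends (induced ends (↑U) ω) x z) :
    ConnSet ends (induced ends (↑U) ω) X Y ↔ ConnSet ends (induced ends (↑(U \ {z})) ω) X Y := by
  constructor
  · rintro ⟨x, hx, y, hy, hxy⟩
    rcases conn_sdiff_or_conn_z (z := z) hxy with h | h
    · exact ⟨x, hx, y, hy, h⟩
    · exact absurd h (hX x hx)
  · exact connSet_mono_config (induced_mono_set (Finset.coe_subset.2 Finset.sdiff_subset) ω)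

omit [Fintype E] in
/-- Monotonicity: `X ↔ Y` in `G[U ∖ z]` implies `X ↔ Y` in `G[U]`. -/
lemma connSet_of_sdiff {X Y : Finset V} (h : ConnSet ends (induced ends (↑(U \ {z})) ω) X Y) :
    ConnSet ends (induced ends (↑U) ω) X Y :=
  connSet_mono_config (induced_mono_set (Finset.coe_subset.2 Finset.sdiff_subset) ω) h

end Reveal

/-! ## Degenerate cells and set identities -/

section Degenerate

variable {V : Type*} {E : Type*} [DecidableEq V] {ends : E → Sym2 V} {U : Finset V} {s t v : V}

/-- `a` is empty when `s` lies in a frontier set. -/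
lemma aEv_eq_empty_of_mem_s {A W : Finset V} (h : s ∈ A ∪ W) : aEv ends U s t v A W = ∅ := by
  ext ω
  simp only [Set.mem_empty_iff_false, iff_false]
  rintro ⟨_, _, h3, _, _⟩
  refine h3 ⟨s, Finset.mem_singleton_self s, s, ?_, conn_refl _ _ _⟩
  rw [Finset.union_assoc]
  exact Finset.mem_union_right _ h

/-- `a` is empty when `v` lies in a frontier set. -/
lemma aEv_eq_empty_of_mem_v {A W : Finset V} (h : v ∈ A ∪ W) : aEv ends U s t v A W = ∅ := by
  ext ω
  simp only [Set.mem_empty_iff_false, iff_false]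
  rintro ⟨h1, _, h3, _, _⟩
  refine h3 ⟨s, Finset.mem_singleton_self s, v, ?_, conn_symm h1⟩
  rw [Finset.union_assoc]
  exact Finset.mem_union_right _ h

/-- `a` is empty when the two frontier sets meet. -/
lemma aEv_eq_empty_of_overlap {A W : Finset V} {z : V} (hA : z ∈ A) (hW : z ∈ W) :
    aEv ends U s t v A W = ∅ := by
  ext ω
  simp only [Set.mem_empty_iff_false, iff_false]
  rintro ⟨_, _, _, _, h5⟩
  exact h5 ⟨z, hW, z, hA, conn_refl _ _ _⟩

/-- `b` is empty when `t` lies in a frontier set. -/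
lemma bEv_eq_empty_of_mem_t {A W : Finset V} (h : t ∈ A ∪ W) : bEv ends U s t v A W = ∅ := by
  ext ω
  simp only [Set.mem_empty_iff_false, iff_false]
  rintro ⟨_, _, h3, _, _⟩
  refine h3 ⟨t, Finset.mem_singleton_self t, t, ?_, conn_refl _ _ _⟩
  rw [Finset.union_assoc]
  exact Finset.mem_union_right _ h

/-- `b` is empty when the two frontier sets meet. -/
lemma bEv_eq_empty_of_overlap {A W : Finset V} {z : V} (hA : z ∈ A) (hW : z ∈ W) :
    bEv ends U s t v A W = ∅ := by
  ext ω
  simp only [Set.mem_empty_iff_false, iff_false]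
  rintro ⟨_, _, _, _, h5⟩
  exact h5 ⟨z, hA, z, hW, conn_refl _ _ _⟩

/-- `(A ∪ B) ∖ z ∪ (F ∪ F') = (A ∖ z ∪ F) ∪ (B ∖ z ∪ F')`. -/
lemma erase_union_union (A B F F' : Finset V) (z : V) :
    (A ∪ B).erase z ∪ (F ∪ F') = (A.erase z ∪ F) ∪ (B.erase z ∪ F') := by
  ext x
  simp only [Finset.mem_union, Finset.mem_erase]
  tauto

/-- `(A ∩ B) ∖ z ∪ (F ∩ F') ⊆ (A ∖ z ∪ F) ∩ (B ∖ z ∪ F')`. -/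
lemma erase_inter_subset (A B F F' : Finset V) (z : V) :
    (A ∩ B).erase z ∪ (F ∩ F') ⊆ (A.erase z ∪ F) ∩ (B.erase z ∪ F') := by
  intro x hx
  simp only [Finset.mem_union, Finset.mem_erase, Finset.mem_inter] at hx ⊢
  tauto

/-- `A ∩ B ⊆ (A ∖ z ∪ F) ∩ B` when `z ∉ B`. -/
lemma inter_subset_erase_union_left {A B F : Finset V} {z : V} (hzB : z ∉ B) :
    A ∩ B ⊆ (A.erase z ∪ F) ∩ B := by
  intro x hx
  have : x ≠ z := fun h => hzB (h ▸ (Finset.mem_inter.1 hx).2)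
  simp only [Finset.mem_inter, Finset.mem_union, Finset.mem_erase] at hx ⊢
  tauto

/-- `A ∩ B ⊆ A ∩ (B ∖ z ∪ F)` when `z ∉ A`. -/
lemma inter_subset_erase_union_right {A B F : Finset V} {z : V} (hzA : z ∉ A) :
    A ∩ B ⊆ A ∩ (B.erase z ∪ F) := by
  intro x hx
  have : x ≠ z := fun h => hzA (h ▸ (Finset.mem_inter.1 hx).1)
  simp only [Finset.mem_inter, Finset.mem_union, Finset.mem_erase] at hx ⊢
  tauto

end Degenerate

end BTVFamily

end Summit.Ventures.PercRepro2
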